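import Mathlib
import Summits.ValiantsHypothesis.ValiantsHypothesis.Theorems.NewtonUnitEquationsDissociatedUniformTotalsLaw
import Summits.ValiantsHypothesis.ValiantsHypothesis.Theorems.NewtonUnitEquationsDissociatedUniformTotalsLawUnionConverse
import Literature.Computability.AlgebraicComplexity.NewtonPolygonTauProductBounds
import HarnessLib

/-!
# Crux `NewtonUnitEquations.DissociatedUniform` (stmt-ValiantsHypothesis-5905), `n = 3` totals law of model (Q**):
# the HEXAGON CRITERION — a class-hull vertex is a fold vertex of the lattice map

Model (Q**) (`…TotalsLaw`: `classPts a b c s = {a x + b y + c z : x + y + z = s}`, `V_s = classVert`, `T = totalVert`) over the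
cyclic label group `ℤ/q`.  Class `s` is parametrised by the torus `(x, y) ∈ (ℤ/q)²` (`z = s - x - y`), which carries the
triangular-lattice structure with the six neighbours `(x±1, y)`, `(x, y±1)`, `(x+1, y-1)`, `(x-1, y+1)` of a label pair; the
map `(x, y) ↦ a x + b y + c (s - x - y)` is a piecewise-linear map of this triangulated torus to the plane.  THIS FILE proves the
purely local necessary condition for a class point to be a hull vertex:

* `six_turn`: six plane vectors `d₁, …, d₆` with `det(dᵢ, dᵢ₊₁) > 0` cyclically cannot all lie in an open half-plane
  `{⟨w, ·⟩ < 0}` (they wind around the origin);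
* `cross2_hexagon₁ … ₆`: for the six lattice neighbours `nᵢ` of `v = a x + b y + c z` (in cyclic order) the turning
  determinants `det(nᵢ - v, nᵢ₊₁ - v)` are the ORIENTATIONS `orientT a b c i j k = orient(Δa i, Δb j, Δc k)` of the triples of
  EDGE VECTORS (`edgeVec f i = f (i+1) - f i`) at the six index triples `(i,j,k) ∈ {x-1,x} × {y-1,y} × {z-1,z}` with
  `i + j + k ∈ {s-1, s-2}` — the hexagon of the `2×2×2` cube below `(x, y, z)`;
* **`not_mem_extremePoints_of_hexPos` / `_of_hexNeg`**: if these six orientations are all `> 0` (or all `< 0`) then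
  `a x + b y + c z` is NOT a vertex of `conv(class s)` (a vertex is a strict top for some weight `w`,
  `KPTT.PlanarMinkowski.exists_isStrictTop_of_mem_extremePoints`, so all `⟨w, nᵢ - v⟩ < 0`, contradicting `six_turn`).

Consequence (next files `…TotalsLawHexagonCount`, `…TotalsLawHodograph`): `T ≤ #{(x,y,z) : the hexagon of (x,y,z) is not
constant-sign}`, a count of SIGN CHANGES of the orientation tensor `(i,j,k) ↦ orient(Δa i, Δb j, Δc k)` along lattice
directions, which is `O(q²)` when the three hodographs `Δa, Δb, Δc` are convexly ordered.  Nothing here is specific to convex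
curves: the criterion holds for all `a, b, c`.  `TotalsLawThree C` itself remains OPEN; VP ≠ VNP is not touched.
[folklore: a vertex of the convex hull of a finite planar set is exposed; vectors turning through positive angles `< π` that
return to the start wind around the origin at least once]
-/

set_option linter.dupNamespace false -- `ValiantsHypothesis.ValiantsHypothesis` (summit = problem) in every name

open scoped BigOperators Pointwise

namespace Summit.ValiantsHypothesis.ValiantsHypothesis.Theorems.NewtonUnitEquationsDissociatedUniform

namespace TotalsLaw

open Literature.Computability.AlgebraicComplexity.KPTT.PlanarMinkowski Matrix

/-! ### Plane vectors: cross product, orientation, the six-turn lemma -/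

/-- The planar cross product `det(u, v) = u₀ v₁ - u₁ v₀`. [folklore] -/
def cross2 (u v : Fin 2 → ℝ) : ℝ := u 0 * v 1 - u 1 * v 0

/-- The orientation `det(B - A, C - A)` of the point triple `(A, B, C)` (twice the signed area). [folklore] -/
def orient3 (A B C : Fin 2 → ℝ) : ℝ := cross2 (B - A) (C - A)

/-- `cross2` is alternating. [folklore] -/
theorem cross2_swap (u v : Fin 2 → ℝ) : cross2 v u = -cross2 u v := by
  unfold cross2; ring

/-- `cross2 u u = 0`. [folklore] -/
theorem cross2_self (u : Fin 2 → ℝ) : cross2 u u = 0 := by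
  unfold cross2; ring

/-- The pairing of a weight with a plane vector in coordinates. [folklore] -/
theorem dotProduct_fin_two (w d : Fin 2 → ℝ) : w ⬝ᵥ d = w 0 * d 0 + w 1 * d 1 := by
  simp [dotProduct, Fin.sum_univ_two]

/-- The planar Binet–Cauchy identity behind `six_turn`: with `p = ⟨w, ·⟩` and `q = ⟨w^⊥, ·⟩`,
`p(u) q(v) - q(u) p(v) = |w|² det(u, v)`. [folklore] -/
private theorem pq_sub_qp_eq (w u v : Fin 2 → ℝ) :
    (w 0 * u 0 + w 1 * u 1) * (-w 1 * v 0 + w 0 * v 1) - (-w 1 * u 0 + w 0 * u 1) * (w 0 * v 0 + w 1 * v 1) =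
      (w 0 ^ 2 + w 1 ^ 2) * cross2 u v := by
  unfold cross2; ring

/-- Ratio step: for negative `p, p'`, `q p' < p q'` gives `q / p < q' / p'`. [folklore] -/
private theorem div_lt_div_of_neg {p q p' q' : ℝ} (hp : p < 0) (hp' : p' < 0) (h : 0 < p * q' - q * p') :
    q / p < q' / p' := by
  have hsub : q' / p' - q / p = (q' * p - p' * q) / (p' * p) := div_sub_div _ _ hp'.ne hp.ne
  have hpos : 0 < (q' * p - p' * q) / (p' * p) := div_pos (by linarith) (mul_pos_of_neg_of_neg hp' hp)
  linarith

/-- **Six-turn lemma.**  If six plane vectors turn through positive determinants cyclically,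
`det(d₁,d₂), det(d₂,d₃), …, det(d₆,d₁) > 0`, they do not all lie in an open half-plane `{⟨w, ·⟩ < 0}`: writing
`dᵢ = pᵢ w + qᵢ w^⊥` with all `pᵢ < 0`, positivity of the determinants says `qᵢ/pᵢ` increases strictly around the cycle.
[folklore] -/
theorem six_turn {d₁ d₂ d₃ d₄ d₅ d₆ w : Fin 2 → ℝ}
    (h₁ : 0 < cross2 d₁ d₂) (h₂ : 0 < cross2 d₂ d₃) (h₃ : 0 < cross2 d₃ d₄)
    (h₄ : 0 < cross2 d₄ d₅) (h₅ : 0 < cross2 d₅ d₆) (h₆ : 0 < cross2 d₆ d₁)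
    (hw₁ : w ⬝ᵥ d₁ < 0) (hw₂ : w ⬝ᵥ d₂ < 0) (hw₃ : w ⬝ᵥ d₃ < 0)
    (hw₄ : w ⬝ᵥ d₄ < 0) (hw₅ : w ⬝ᵥ d₅ < 0) (hw₆ : w ⬝ᵥ d₆ < 0) : False := by
  rw [dotProduct_fin_two] at hw₁ hw₂ hw₃ hw₄ hw₅ hw₆
  have hN : 0 < w 0 ^ 2 + w 1 ^ 2 := by
    by_contra hle
    have h0 : w 0 = 0 := by nlinarith [sq_nonneg (w 0), sq_nonneg (w 1)]
    have h1 : w 1 = 0 := by nlinarith [sq_nonneg (w 0), sq_nonneg (w 1)]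
    rw [h0, h1] at hw₁
    linarith
  -- the six ratio steps
  have s₁ := div_lt_div_of_neg hw₁ hw₂ (by rw [pq_sub_qp_eq]; exact mul_pos hN h₁)
  have s₂ := div_lt_div_of_neg hw₂ hw₃ (by rw [pq_sub_qp_eq]; exact mul_pos hN h₂)
  have s₃ := div_lt_div_of_neg hw₃ hw₄ (by rw [pq_sub_qp_eq]; exact mul_pos hN h₃)
  have s₄ := div_lt_div_of_neg hw₄ hw₅ (by rw [pq_sub_qp_eq]; exact mul_pos hN h₄)
  have s₅ := div_lt_div_of_neg hw₅ hw₆ (by rw [pq_sub_qp_eq]; exact mul_pos hN h₅)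
  have s₆ := div_lt_div_of_neg hw₆ hw₁ (by rw [pq_sub_qp_eq]; exact mul_pos hN h₆)
  linarith

/-! ### Edge vectors and the orientation tensor -/

section Hexagon

variable {q : ℕ} [NeZero q]

/-- The edge vector `Δf i = f (i + 1) - f i` of a closed curve `f : ℤ/q → ℝ²` (its HODOGRAPH is `i ↦ Δf i`). [folklore] -/
def edgeVec (f : ZMod q → (Fin 2 → ℝ)) (i : ZMod q) : Fin 2 → ℝ := f (i + 1) - f i

/-- The ORIENTATION TENSOR of three curves: `orientT a b c i j k = orient(Δa i, Δb j, Δc k)`, the orientation of the triangle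
formed by the three edge vectors viewed as points. -/
def orientT (a b c : ZMod q → (Fin 2 → ℝ)) (i j k : ZMod q) : ℝ :=
  orient3 (edgeVec a i) (edgeVec b j) (edgeVec c k)

/-- The hexagon of `(x, y, z)` is POSITIVE: the six orientations `orientT a b c i j k` at
`(x,y,z-1), (x-1,y,z-1), (x-1,y,z), (x-1,y-1,z), (x,y-1,z), (x,y-1,z-1)` are all `> 0`. -/
def HexPos (a b c : ZMod q → (Fin 2 → ℝ)) (x y z : ZMod q) : Prop :=
  0 < orientT a b c x y (z - 1) ∧ 0 < orientT a b c (x - 1) y (z - 1) ∧ 0 < orientT a b c (x - 1) y z ∧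
    0 < orientT a b c (x - 1) (y - 1) z ∧ 0 < orientT a b c x (y - 1) z ∧ 0 < orientT a b c x (y - 1) (z - 1)

/-- The hexagon of `(x, y, z)` is NEGATIVE: the same six orientations are all `< 0`. -/
def HexNeg (a b c : ZMod q → (Fin 2 → ℝ)) (x y z : ZMod q) : Prop :=
  orientT a b c x y (z - 1) < 0 ∧ orientT a b c (x - 1) y (z - 1) < 0 ∧ orientT a b c (x - 1) y z < 0 ∧
    orientT a b c (x - 1) (y - 1) z < 0 ∧ orientT a b c x (y - 1) z < 0 ∧ orientT a b c x (y - 1) (z - 1) < 0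

variable (a b c : ZMod q → (Fin 2 → ℝ)) (x y z : ZMod q)

omit [NeZero q] in
/-- Hexagon edge 1 → 2: `det(n₁ - v, n₂ - v) = orient(Δa x, Δb y, Δc (z-1))` for `n₁ = (x+1, y, z-1)`, `n₂ = (x, y+1, z-1)`.
[folklore] -/
theorem cross2_hexagon₁ :
    cross2 (a (x + 1) + b y + c (z - 1) - (a x + b y + c z)) (a x + b (y + 1) + c (z - 1) - (a x + b y + c z)) =
      orientT a b c x y (z - 1) := by
  simp only [orientT, orient3, edgeVec, cross2, Pi.add_apply, Pi.sub_apply, sub_add_cancel]; ring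

omit [NeZero q] in
/-- Hexagon edge 2 → 3: `n₂ = (x, y+1, z-1)`, `n₃ = (x-1, y+1, z)`; orientation at `(x-1, y, z-1)`. [folklore] -/
theorem cross2_hexagon₂ :
    cross2 (a x + b (y + 1) + c (z - 1) - (a x + b y + c z)) (a (x - 1) + b (y + 1) + c z - (a x + b y + c z)) =
      orientT a b c (x - 1) y (z - 1) := by
  simp only [orientT, orient3, edgeVec, cross2, Pi.add_apply, Pi.sub_apply, sub_add_cancel]; ring

omit [NeZero q] in
/-- Hexagon edge 3 → 4: `n₃ = (x-1, y+1, z)`, `n₄ = (x-1, y, z+1)`; orientation at `(x-1, y, z)`. [folklore] -/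
theorem cross2_hexagon₃ :
    cross2 (a (x - 1) + b (y + 1) + c z - (a x + b y + c z)) (a (x - 1) + b y + c (z + 1) - (a x + b y + c z)) =
      orientT a b c (x - 1) y z := by
  simp only [orientT, orient3, edgeVec, cross2, Pi.add_apply, Pi.sub_apply, sub_add_cancel]; ring

omit [NeZero q] in
/-- Hexagon edge 4 → 5: `n₄ = (x-1, y, z+1)`, `n₅ = (x, y-1, z+1)`; orientation at `(x-1, y-1, z)`. [folklore] -/
theorem cross2_hexagon₄ :
    cross2 (a (x - 1) + b y + c (z + 1) - (a x + b y + c z)) (a x + b (y - 1) + c (z + 1) - (a x + b y + c z)) =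
      orientT a b c (x - 1) (y - 1) z := by
  simp only [orientT, orient3, edgeVec, cross2, Pi.add_apply, Pi.sub_apply, sub_add_cancel]; ring

omit [NeZero q] in
/-- Hexagon edge 5 → 6: `n₅ = (x, y-1, z+1)`, `n₆ = (x+1, y-1, z)`; orientation at `(x, y-1, z)`. [folklore] -/
theorem cross2_hexagon₅ :
    cross2 (a x + b (y - 1) + c (z + 1) - (a x + b y + c z)) (a (x + 1) + b (y - 1) + c z - (a x + b y + c z)) =
      orientT a b c x (y - 1) z := by
  simp only [orientT, orient3, edgeVec, cross2, Pi.add_apply, Pi.sub_apply, sub_add_cancel]; ring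

omit [NeZero q] in
/-- Hexagon edge 6 → 1: `n₆ = (x+1, y-1, z)`, `n₁ = (x+1, y, z-1)`; orientation at `(x, y-1, z-1)`. [folklore] -/
theorem cross2_hexagon₆ :
    cross2 (a (x + 1) + b (y - 1) + c z - (a x + b y + c z)) (a (x + 1) + b y + c (z - 1) - (a x + b y + c z)) =
      orientT a b c x (y - 1) (z - 1) := by
  simp only [orientT, orient3, edgeVec, cross2, Pi.add_apply, Pi.sub_apply, sub_add_cancel]; ring

variable {a b c x y z}

/-- Lattice neighbours are class points: `a x' + b y' + c z' ∈ class s` whenever `x' + y' + z' = s`. [folklore] -/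
theorem mem_classFin_of_sum_eq {s x' y' z' : ZMod q} (h : x' + y' + z' = s) :
    a x' + b y' + c z' ∈ classFin a b c s := by
  classical
  unfold classFin
  refine Finset.mem_image.2 ⟨(x', y'), Finset.mem_univ _, ?_⟩
  simp only
  rw [show s - x' - y' = z' by rw [← h]; ring]

/-- A strict top sees every OTHER class point strictly below it; a class point `n` with `det(n - v, ·) ≠ 0`-type information
is different from `v`, so: if `n ∈ class s` and `n ≠ v` then `⟨w, n - v⟩ < 0`. [folklore] -/
theorem dotProduct_sub_neg_of_isStrictTop {w v n : Fin 2 → ℝ} {F : Finset (Fin 2 → ℝ)} (hv : IsStrictTop w F v)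
    (hn : n ∈ F) (hne : n ≠ v) : w ⬝ᵥ (n - v) < 0 := by
  rw [dotProduct_sub, sub_neg]
  exact hv.lt hn hne

/-- If `det(n - v, m - v) ≠ 0` then `n ≠ v`. [folklore] -/
theorem ne_of_cross2_ne_zero_left {v n m : Fin 2 → ℝ} (h : cross2 (n - v) (m - v) ≠ 0) : n ≠ v := by
  rintro rfl
  exact h (by rw [sub_self]; unfold cross2; simp)

/-- **Hexagon criterion (positive).**  If the six orientations around `(x, y, z)`, `z = s - x - y`, are all positive, the class
point `a x + b y + c z` is not a vertex of `conv(class s)`: a vertex is a strict top for some weight `w`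
(`exists_isStrictTop_of_mem_extremePoints`), its six lattice neighbours are class points strictly below it, and `six_turn`
forbids that. [folklore] -/
theorem not_mem_extremePoints_of_hexPos {s x y : ZMod q} (h : HexPos a b c x y (s - x - y)) :
    a x + b y + c (s - x - y) ∉ (convexHull ℝ (classPts a b c s)).extremePoints ℝ := by
  classical
  intro hext
  set z := s - x - y with hz
  obtain ⟨o₁, o₂, o₃, o₄, o₅, o₆⟩ := h
  rw [← coe_classFin] at hext
  obtain ⟨w, hw⟩ := exists_isStrictTop_of_mem_extremePoints hext
  -- the six neighbours are class points
  have m₁ : a (x + 1) + b y + c (z - 1) ∈ classFin a b c s := mem_classFin_of_sum_eq (by rw [hz]; ring)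
  have m₂ : a x + b (y + 1) + c (z - 1) ∈ classFin a b c s := mem_classFin_of_sum_eq (by rw [hz]; ring)
  have m₃ : a (x - 1) + b (y + 1) + c z ∈ classFin a b c s := mem_classFin_of_sum_eq (by rw [hz]; ring)
  have m₄ : a (x - 1) + b y + c (z + 1) ∈ classFin a b c s := mem_classFin_of_sum_eq (by rw [hz]; ring)
  have m₅ : a x + b (y - 1) + c (z + 1) ∈ classFin a b c s := mem_classFin_of_sum_eq (by rw [hz]; ring)
  have m₆ : a (x + 1) + b (y - 1) + c z ∈ classFin a b c s := mem_classFin_of_sum_eq (by rw [hz]; ring)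
  -- turning determinants
  rw [← cross2_hexagon₁ a b c x y z] at o₁
  rw [← cross2_hexagon₂ a b c x y z] at o₂
  rw [← cross2_hexagon₃ a b c x y z] at o₃
  rw [← cross2_hexagon₄ a b c x y z] at o₄
  rw [← cross2_hexagon₅ a b c x y z] at o₅
  rw [← cross2_hexagon₆ a b c x y z] at o₆
  exact six_turn o₁ o₂ o₃ o₄ o₅ o₆
    (dotProduct_sub_neg_of_isStrictTop hw m₁ (ne_of_cross2_ne_zero_left o₁.ne'))
    (dotProduct_sub_neg_of_isStrictTop hw m₂ (ne_of_cross2_ne_zero_left o₂.ne'))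
    (dotProduct_sub_neg_of_isStrictTop hw m₃ (ne_of_cross2_ne_zero_left o₃.ne'))
    (dotProduct_sub_neg_of_isStrictTop hw m₄ (ne_of_cross2_ne_zero_left o₄.ne'))
    (dotProduct_sub_neg_of_isStrictTop hw m₅ (ne_of_cross2_ne_zero_left o₅.ne'))
    (dotProduct_sub_neg_of_isStrictTop hw m₆ (ne_of_cross2_ne_zero_left o₆.ne'))

/-- **Hexagon criterion (negative).**  The same with all six orientations negative (reverse the cyclic order). [folklore] -/
theorem not_mem_extremePoints_of_hexNeg {s x y : ZMod q} (h : HexNeg a b c x y (s - x - y)) :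
    a x + b y + c (s - x - y) ∉ (convexHull ℝ (classPts a b c s)).extremePoints ℝ := by
  classical
  intro hext
  set z := s - x - y with hz
  obtain ⟨o₁, o₂, o₃, o₄, o₅, o₆⟩ := h
  rw [← coe_classFin] at hext
  obtain ⟨w, hw⟩ := exists_isStrictTop_of_mem_extremePoints hext
  have m₁ : a (x + 1) + b y + c (z - 1) ∈ classFin a b c s := mem_classFin_of_sum_eq (by rw [hz]; ring)
  have m₂ : a x + b (y + 1) + c (z - 1) ∈ classFin a b c s := mem_classFin_of_sum_eq (by rw [hz]; ring)
  have m₃ : a (x - 1) + b (y + 1) + c z ∈ classFin a b c s := mem_classFin_of_sum_eq (by rw [hz]; ring)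
  have m₄ : a (x - 1) + b y + c (z + 1) ∈ classFin a b c s := mem_classFin_of_sum_eq (by rw [hz]; ring)
  have m₅ : a x + b (y - 1) + c (z + 1) ∈ classFin a b c s := mem_classFin_of_sum_eq (by rw [hz]; ring)
  have m₆ : a (x + 1) + b (y - 1) + c z ∈ classFin a b c s := mem_classFin_of_sum_eq (by rw [hz]; ring)
  rw [← cross2_hexagon₁ a b c x y z] at o₁
  rw [← cross2_hexagon₂ a b c x y z] at o₂
  rw [← cross2_hexagon₃ a b c x y z] at o₃
  rw [← cross2_hexagon₄ a b c x y z] at o₄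
  rw [← cross2_hexagon₅ a b c x y z] at o₅
  rw [← cross2_hexagon₆ a b c x y z] at o₆
  -- reverse the cycle: det(n_{i+1} - v, n_i - v) = -det(n_i - v, n_{i+1} - v) > 0
  have r₁ := (cross2_swap _ _).symm ▸ neg_pos.2 o₁
  have r₂ := (cross2_swap _ _).symm ▸ neg_pos.2 o₂
  have r₃ := (cross2_swap _ _).symm ▸ neg_pos.2 o₃
  have r₄ := (cross2_swap _ _).symm ▸ neg_pos.2 o₄
  have r₅ := (cross2_swap _ _).symm ▸ neg_pos.2 o₅
  have r₆ := (cross2_swap _ _).symm ▸ neg_pos.2 o₆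
  exact six_turn r₆ r₅ r₄ r₃ r₂ r₁
    (dotProduct_sub_neg_of_isStrictTop hw m₁ (ne_of_cross2_ne_zero_left o₁.ne))
    (dotProduct_sub_neg_of_isStrictTop hw m₆ (ne_of_cross2_ne_zero_left o₆.ne))
    (dotProduct_sub_neg_of_isStrictTop hw m₅ (ne_of_cross2_ne_zero_left o₅.ne))
    (dotProduct_sub_neg_of_isStrictTop hw m₄ (ne_of_cross2_ne_zero_left o₄.ne))
    (dotProduct_sub_neg_of_isStrictTop hw m₃ (ne_of_cross2_ne_zero_left o₃.ne))
    (dotProduct_sub_neg_of_isStrictTop hw m₂ (ne_of_cross2_ne_zero_left o₂.ne))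

/-- **Contrapositive: every class-hull vertex is a fold vertex.**  If `a x + b y + c (s - x - y)` is a vertex of `conv(class s)`
then its hexagon is neither positive nor negative (some two consecutive orientations differ in sign or vanish). [folklore] -/
theorem not_hexPos_and_not_hexNeg_of_mem_extremePoints {s x y : ZMod q}
    (h : a x + b y + c (s - x - y) ∈ (convexHull ℝ (classPts a b c s)).extremePoints ℝ) :
    ¬ HexPos a b c x y (s - x - y) ∧ ¬ HexNeg a b c x y (s - x - y) :=
  ⟨fun hp => not_mem_extremePoints_of_hexPos hp h, fun hn => not_mem_extremePoints_of_hexNeg hn h⟩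

end Hexagon

end TotalsLaw

end Summit.ValiantsHypothesis.ValiantsHypothesis.Theorems.NewtonUnitEquationsDissociatedUniform
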